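import Summits.SmoothPoincare4.SmoothPoincare4.Theses.EinsteinBulk
import Summits.SmoothPoincare4.SmoothPoincare4.Theses.InformationMetricHadamard

/-!
# Crux `PEFillNearRound` (item stmt-SmoothPoincare4-7997, shared by routes `EinsteinBulk` and
# `InformationMetricHadamard`) — LEAD SKELETON of line `Sketch`, RESHAPED (cycle 1) onto the route-level
# split `standard-or-gap`: the two stubs ARE the route items `PEFillStandardSphere` (stmt-SmoothPoincare4-18033)
# and `YamabeNearRoundSpheresStandard` (stmt-SmoothPoincare4-18032), BY NAME

Lead: prover-line-stmt-SmoothPoincare4-7997-0 (2026-08-17). History: the birth skeleton `standard-or-thin`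
(crux-strategist of 6014; stubs `stub_peFillStandard` = 18033 verbatim, `stub_exoticYamabeGap` = the negative
form of 18032; kept as `work/PEFillNearRound.v1_standard_or_thin.lean`) was registered first; the crux-strategist
of 7997 (r1, `Lines/route_split.lean`, DECOMPOSITION.md) then filed both halves as route cruxes with their own
registered skeletons (`Lines/piece_X1_valley_continuity.lean` for 18033: openness / closedness / round class
filled / VALLEY; `Lines/piece_X2_qc_smoothing.lean` for 18032), so this skeleton now composes the crux from the
two ITEMS by name: when they close, their `_holds` links are the stub proofs.

LANDED by this line (Theorems/): `EinsteinBulkPEFillNearRoundSplit.lean` (glue `peFillNearRoundOfPieces_proof`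
for both routes, exactness `PEFillNearRound → 18033` and `LQS → PEFillNearRound → 18032` via the proved recogniser
7999, SPC4 sandwich of 18032, registered logical helpers), and the ROUND CLASS FILLED base point of 18033's
continuity skeleton = item 8003 `RoundSphereBoundsHyperbolicSpace` (`EinsteinBulkPEFillNearRoundRoundFilled.lean`
+ five `EinsteinBulkPEFillNearRoundRf*.lean` pieces: hyperbolic 5-space compactified on the closed 5-ball).

Both stubs are open problems (large-data Poincaré–Einstein existence on `B⁵` in the Yamabe-near-round cone;
Yamabe-near-round homotopy 4-spheres are standard = the SPC4 half); nothing in this file is claimed beyond the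
kernel-checked composition.
-/

noncomputable section

-- the prescribed namespace `Summit.<P>.<Sub>.…` duplicates `SmoothPoincare4` (P = Sub)
set_option linter.dupNamespace false

open scoped Manifold ContDiff Topology ContinuousMap
open Summit.SmoothPoincare4.SmoothPoincare4.Theses

namespace Summit.SmoothPoincare4.SmoothPoincare4.Cruxes.PEFillNearRound.Sketch

/-- **Stub 1 = item stmt-SmoothPoincare4-18033 `EinsteinBulk.PEFillStandardSphere`** — PE-FILL(δ) on closed
smooth 4-manifolds DIFFEOMORPHIC to `S⁴`: there is `δ > 0` such that every metric `g₀` with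
`Y(M,[g₀]) ≥ (1−δ)·8√6π` is the conformal infinity of a `C²`-conformally compact Einstein 5-manifold
(`Ric = −4g`, `|dρ|_ḡ = 1`). Plan (its own registered skeleton `piece_X1_valley_continuity`): continuity method
from the round class — OPENNESS (Lee 2006 Thm A at `K ≤ 0`, `K ≤ 0` from Li–Qing–Shi pinching), CLOSEDNESS
(Chang–Ge–Jin–Qing compactness III, uniform threshold), ROUND CLASS FILLED (`ℍ⁵`; LANDED:
`RoundFilled.helper_roundFilled` = item 8003), VALLEY (near-maximal superlevel sets of `Y` on `Conf(S⁴)` are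
path connected to the round class). Open problem. [cite: GrahamLee1991] [cite: Lee2006, Thm A]
[cite: LiQingShi2017, Thm 1.8] -/
theorem stub_peFillStandardSphere : EinsteinBulk.PEFillStandardSphere := by
  sorry

/-- **Stub 2 = item stmt-SmoothPoincare4-18032 `EinsteinBulk.YamabeNearRoundSpheresStandard`** —
Yamabe-near-round homotopy 4-spheres are standard: there is `δ > 0` such that every closed smooth `M ≃ₕ S⁴`
carrying a metric `g₀` with `Y(M,[g₀]) ≥ (1−δ)·8√6π` is diffeomorphic to `S⁴` (the positive form of the uniform
Yamabe GAP for exotica; `SmoothPoincare4 →` it, and it `→ YamabeExtremalSpheres → SmoothPoincare4`, both LANDED in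
`Theorems.PEFillNearRoundSplit`). Plan (its own registered skeleton `piece_X2_qc_smoothing`): δ-near-round ⇒
(1+ε)-quasiconformal to round; (1+ε)-qc homotopy 4-spheres are smoothable to a diffeomorphism. Open problem
(SPC4-adjacent). [cite: Kobayashi1987] [cite: Schoen1989] -/
theorem stub_yamabeNearRoundSpheresStandard : EinsteinBulk.YamabeNearRoundSpheresStandard := by
  sorry

/-- Monotonicity of the inlined Yamabe lower bound `(1 - δ)·C·√V ≤ I` in the slack parameter `δ`
(copy of `Theorems.PEFillNearRoundSplit.yamabeBound_mono`, inlined so that this workfile elaborates on its own). -/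
theorem yamabeBound_mono {δ δ' C V I : ℝ} (hδ : δ' ≤ δ) (hC : 0 ≤ C) (hV : 0 ≤ V)
    (h : (1 - δ') * C * V ≤ I) : (1 - δ) * C * V ≤ I :=
  (mul_le_mul_of_nonneg_right (mul_le_mul_of_nonneg_right (sub_le_sub_left hδ 1) hC) hV).trans h

/-- The glue of the split (copy of the LANDED `Theorems.PEFillNearRoundSplit.peFillNearRoundOfPieces_proof`):
`δ := min δ₁ δ₂`; stub 2 recognises `M ≅ S⁴`, stub 1 fills `(M,[g₀])`. -/
theorem peFillNearRound_of_pieces (h1 : EinsteinBulk.PEFillStandardSphere)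
    (h2 : EinsteinBulk.YamabeNearRoundSpheresStandard) : EinsteinBulk.PEFillNearRound := by
  obtain ⟨δ₁, hδ₁, H1⟩ := h1
  obtain ⟨δ₂, hδ₂, H2⟩ := h2
  refine ⟨min δ₁ δ₂, lt_min hδ₁ hδ₂, ?_⟩
  intro M _ _ _ _ _ _ _ _ _ he g₀ hY
  have hstd : Nonempty (M ≃ₘ⟮𝓡 4, 𝓡 4⟯ Metric.sphere (0 : EuclideanSpace ℝ (Fin 5)) 1) :=
    H2 M he g₀ (fun h' _ hconf =>
      yamabeBound_mono (min_le_right _ _) (by positivity) (Real.sqrt_nonneg _) (hY h' hconf))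
  exact H1 M hstd g₀ (fun h' _ hconf =>
    yamabeBound_mono (min_le_left _ _) (by positivity) (Real.sqrt_nonneg _) (hY h' hconf))

/-- **THE SKELETON THEOREM: the crux BY NAME (route `EinsteinBulk`) from the two registered stubs**
(sorries only inside `stub_*`). -/
theorem PEFillNearRound_of : EinsteinBulk.PEFillNearRound :=
  peFillNearRound_of_pieces stub_peFillStandardSphere stub_yamabeNearRoundSpheresStandard

/-- **The skeleton theorem for the second route wanting this crux**: `InformationMetricHadamard.PEFillNearRound`
has the same statement text (the two route defs unfold to one proposition). -/
theorem PEFillNearRound_of' : InformationMetricHadamard.PEFillNearRound :=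
  PEFillNearRound_of

end Summit.SmoothPoincare4.SmoothPoincare4.Cruxes.PEFillNearRound.Sketch

end
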